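import Mathlib
import Literature.NumberTheory.LFunctions.Zhang2022.Section4Eq48Deduction
import Literature.NumberTheory.LFunctions.Zhang2022.Section4WeightedAbel
import HarnessLib

/-!
# Zhang (2022) §4, Lemma 4.4: the `g`-weighted partial summation, I — the weight
# `f(x) = g(P^{9/5}/x)x^{s₀−s}` (derivative, size bounds) and the bound for `Σ_{D⁴<n≤b}`, PROVED

Topic `Literature/NumberTheory/LFunctions/Zhang2022` (Landau–Siegel adjudication tree;
verdict-neutral). Y. Zhang, *Discrete mean estimates and the Landau–Siegel zero*,
arXiv:2211.02515v1 (2022) [Zhang2022LandauSiegel] — **an unrefereed manuscript under adjudication**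
— §4, proof of Lemma 4.4, p. 19 (tex L1062–L1066; DAG node `Z22:§4.u028`, first `≪`):

> By (3.5) and partial summation, the second sum on the right side above is
> `= ∫_{D⁴}^{P²} g(P^{9/5}/x) x^{s₀−s} dX₃(x,ψ) ≪ 𝓛₁(|X₃(P²,ψ)| + ∫_{D⁴}^{P²} |X₃(x,ψ)|x⁻¹dx) ≪ 𝓛⁻¹⁸⁰.`

The campaign's statements file types the first `≪` as the node `Section4.GSumBound`
(`Section4Statements.lean`, L1-t3): for every `ψ ∈ Ψ` and `s ∈ Ω₃`,
`|Σ_{D⁴<n<⌈P²⌉} ν(n)ψ(n)n^{−s}g(P^{9/5}/n)| ≤ C𝓛₁(|X₃(P²,ψ)| + ∫_{D⁴}^{P²}|X₃(x,ψ)|x⁻¹dx)`.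
This file and its sibling `Section4GSumBound.lean` PROVE it (theorems only, no new definition, no
new named fact), by the general-weight partial summation of `Section4WeightedAbel` with
`f(x) = g(P^{9/5}/x)·x^{s₀−s}`. Here: the weight's derivative and size bounds and the core bound
`Section4.norm_gSum_Ioc_le` (`|Σ_{D⁴<n≤b} …| ≤ e^{2π}|X₃(b)| + 2e^{2π}𝓛₁∫_{D⁴}^{b}|X₃|x⁻¹dx` for
`D⁴ ≤ b ≤ P²`); the sibling handles the typed range `n < ⌈P²⌉` and concludes `gSumBound_holds`.

* `g(y) = √(Λ/π)∫_{u≤log y}e^{−Λu²}du` (`Λ = 𝓛³⁰`, tree `GaussWeight.gWeight`) has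
  `d/dx g(X/x) = −√(Λ/π)e^{−Λlog²(X/x)}/x` (`hasDerivAt_gWeight_comp_div`, by the fundamental theorem
  of calculus on `(−∞, t]`), so `x|f′(x)| ≤ (√(Λ/π) + |s₀−s|)·sup x^{1/2−σ}` with `0 < g < 1`,
  `e^{−Λu²} ≤ 1`;
* on `Ω₃`, `x^{1/2−σ} ≤ e^{2π}` on `[D⁴, P²]` (`P^{2α} = e^{2π}`) and
  `√(Λ/π) + |s₀ − s| ≤ 𝓛¹⁵ + 𝓛₁ + 4 ≤ 2𝓛₁`;
Nothing about Theorems 1–2 of the source or about Landau–Siegel zeros is stated or implied; the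
second `≪` (`GSumBound180`) and the use of the bound in Lemma 4.4's proof are
`Section4Lemma44Chain.gSumBound180_of` / `ded44_holds`.

## References

* Y. Zhang, arXiv:2211.02515v1 (2022), §4 p. 19 (proof of Lemma 4.4), (4.1)–(4.3) p. 18, (2.6),
  (2.8), (2.10). [cite: Zhang2022LandauSiegel, §4 Lemma 4.4 (proof) p. 19]
-/

noncomputable section

open Complex Real Set MeasureTheory Finset intervalIntegral

namespace Literature.NumberTheory.LFunctions.Zhang2022.Section4

open Skeleton
open Lemma41 (Xsum Xsum_def Xsum_eq_sum_Ioc Xsum_self)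
open GaussWeight (gauss gWeight gauss_pos gWeight_pos gWeight_lt_one continuous_gauss
  integrable_gauss gWeight_le)

/-! ### The derivative of the weight `g(X/x)` -/

/-- FTC on `(−∞, t]` for the Gaussian: `d/dt ∫_{u≤t} e^{−Λu²}du = e^{−Λt²}` (so `g` of (4.1) is
differentiable). [cite: Zhang2022LandauSiegel, §4 (4.1)] -/
theorem hasDerivAt_integral_Iic_gauss {Λ : ℝ} (hΛ : 0 < Λ) (t : ℝ) :
    HasDerivAt (fun t : ℝ => ∫ u in Set.Iic t, gauss Λ u) (gauss Λ t) t := by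
  have h0 : ∀ t : ℝ, ∫ u in Set.Iic t, gauss Λ u
      = (∫ u in Set.Iic 0, gauss Λ u) + ∫ u in (0 : ℝ)..t, gauss Λ u := by
    intro t
    have h := intervalIntegral.integral_Iic_sub_Iic (μ := volume) (f := gauss Λ)
      (integrable_gauss hΛ).integrableOn (integrable_gauss hΛ).integrableOn (a := 0) (b := t)
    linarith
  have hfun : (fun t : ℝ => ∫ u in Set.Iic t, gauss Λ u)
      = fun t => (∫ u in Set.Iic 0, gauss Λ u) + ∫ u in (0 : ℝ)..t, gauss Λ u := funext h0
  rw [hfun]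
  exact ((continuous_gauss Λ).integral_hasStrictDerivAt 0 t).hasDerivAt.const_add _

/-- **`d/dx g(X/x) = −√(Λ/π)·e^{−Λ log²(X/x)}/x`** for `X, x > 0` (`g = gWeight Λ`, (4.1)).
[cite: Zhang2022LandauSiegel, §4 (4.1)] -/
theorem hasDerivAt_gWeight_comp_div {Λ X : ℝ} (hΛ : 0 < Λ) (hX : 0 < X) {x : ℝ} (hx : 0 < x) :
    HasDerivAt (fun y : ℝ => gWeight Λ (X / y))
      (-(Real.sqrt (Λ / π) * gauss Λ (Real.log (X / x)) / x)) x := by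
  have h1 : HasDerivAt (fun y : ℝ => X / y) (-(X * (x ^ 2)⁻¹)) x := by
    simpa only [div_eq_mul_inv, mul_neg] using (hasDerivAt_inv hx.ne').const_mul X
  have h2 : HasDerivAt (fun y : ℝ => Real.log (X / y)) ((X / x)⁻¹ * (-(X * (x ^ 2)⁻¹))) x :=
    (Real.hasDerivAt_log (div_pos hX hx).ne').comp x h1
  have h3 : HasDerivAt (fun y : ℝ => ∫ u in Set.Iic (Real.log (X / y)), gauss Λ u)
      (gauss Λ (Real.log (X / x)) * ((X / x)⁻¹ * (-(X * (x ^ 2)⁻¹)))) x :=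
    (hasDerivAt_integral_Iic_gauss hΛ _).comp x h2
  have h4 := h3.const_mul (Real.sqrt (Λ / π))
  have hval : Real.sqrt (Λ / π) * (gauss Λ (Real.log (X / x)) * ((X / x)⁻¹ * (-(X * (x ^ 2)⁻¹))))
      = -(Real.sqrt (Λ / π) * gauss Λ (Real.log (X / x)) / x) := by
    field_simp
  rw [← hval]
  exact h4

/-- The weight `f(x) = g(X/x)·x^{z}` of the display (`z = s₀ − s`) is differentiable at `x > 0` with
`f′(x) = −√(Λ/π)e^{−Λlog²(X/x)}x^{z}/x + g(X/x)·z·x^{z−1}`. [cite: Zhang2022LandauSiegel, §4 Lemma 4.4 (proof) p. 19] -/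
theorem hasDerivAt_gWeight_mul_cpow {Λ X : ℝ} (hΛ : 0 < Λ) (hX : 0 < X) (z : ℂ) {x : ℝ}
    (hx : 0 < x) :
    HasDerivAt (fun y : ℝ => (gWeight Λ (X / y) : ℂ) * (y : ℂ) ^ z)
      ((((-(Real.sqrt (Λ / π) * gauss Λ (Real.log (X / x)) / x)) : ℝ) : ℂ) * (x : ℂ) ^ z
        + (gWeight Λ (X / x) : ℂ) * (z * (x : ℂ) ^ (z - 1))) x :=
  ((hasDerivAt_gWeight_comp_div hΛ hX hx).ofReal_comp).mul (Lemma41.hasDerivAt_ofReal_cpow z hx)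

/-- Continuity of `f′` on `[a, b]`, `a > 0` (so the Stieltjes integral `∫ g(P^{9/5}/x)x^{s₀−s}dX₃`
may be integrated by parts). [cite: Zhang2022LandauSiegel, §4 Lemma 4.4 (proof) p. 19] -/
theorem continuousOn_deriv_weight {Λ X : ℝ} (hΛ : 0 < Λ) (hX : 0 < X) (z : ℂ) {a b : ℝ}
    (ha : 0 < a) :
    ContinuousOn (fun x : ℝ =>
      (((-(Real.sqrt (Λ / π) * gauss Λ (Real.log (X / x)) / x)) : ℝ) : ℂ) * (x : ℂ) ^ z
        + (gWeight Λ (X / x) : ℂ) * (z * (x : ℂ) ^ (z - 1))) (Set.Icc a b) := by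
  intro x hx
  have hx0 : 0 < x := ha.trans_le hx.1
  refine ContinuousAt.continuousWithinAt ?_
  have hdiv : ContinuousAt (fun y : ℝ => X / y) x := continuousAt_const.div continuousAt_id hx0.ne'
  have hlog : ContinuousAt (fun y : ℝ => Real.log (X / y)) x :=
    (Real.continuousAt_log (div_pos hX hx0).ne').comp hdiv
  have hgauss : ContinuousAt (fun y : ℝ => gauss Λ (Real.log (X / y))) x :=
    (continuous_gauss Λ).continuousAt.comp hlog
  have hphi' : ContinuousAt (fun y : ℝ => -(Real.sqrt (Λ / π) * gauss Λ (Real.log (X / y)) / y)) x :=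
    ((continuousAt_const.mul hgauss).div continuousAt_id hx0.ne').neg
  have hphi : ContinuousAt (fun y : ℝ => gWeight Λ (X / y)) x :=
    (hasDerivAt_gWeight_comp_div hΛ hX hx0).continuousAt
  have hcpow : ContinuousAt (fun y : ℝ => (y : ℂ) ^ z) x :=
    Complex.continuousAt_ofReal_cpow_const x z (Or.inr hx0.ne')
  have hcpow1 : ContinuousAt (fun y : ℝ => (y : ℂ) ^ (z - 1)) x :=
    Complex.continuousAt_ofReal_cpow_const x (z - 1) (Or.inr hx0.ne')
  exact ((Complex.continuous_ofReal.continuousAt.comp hphi').mul hcpow).add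
    ((Complex.continuous_ofReal.continuousAt.comp hphi).mul (continuousAt_const.mul hcpow1))

/-! ### The two size bounds of the weight -/

/-- `e^{−Λu²} ≤ 1` ("a trivial bound"). [cite: Zhang2022LandauSiegel, §4 (4.1)] -/
theorem gauss_le_one {Λ : ℝ} (hΛ : 0 ≤ Λ) (u : ℝ) : gauss Λ u ≤ 1 := by
  unfold GaussWeight.gauss
  rw [Real.exp_le_one_iff]
  nlinarith [sq_nonneg u]

/-- `|f(b)| = g(X/b)·b^{Re z} ≤ M` if `b^{Re z} ≤ M` (`0 < g < 1`).
[cite: Zhang2022LandauSiegel, §4 Lemma 4.4 (proof) p. 19] -/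
theorem norm_weight_le {Λ X : ℝ} (hΛ : 0 < Λ) (z : ℂ) {b M : ℝ} (hb : 0 < b)
    (hM : b ^ z.re ≤ M) : ‖(gWeight Λ (X / b) : ℂ) * (b : ℂ) ^ z‖ ≤ M := by
  rw [norm_mul, Complex.norm_real, Real.norm_eq_abs, abs_of_pos (gWeight_pos hΛ _),
    Complex.norm_cpow_eq_rpow_re_of_pos hb]
  calc gWeight Λ (X / b) * b ^ z.re ≤ 1 * b ^ z.re :=
        mul_le_mul_of_nonneg_right (gWeight_lt_one hΛ _).le (Real.rpow_nonneg hb.le _)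
    _ ≤ M := by rw [one_mul]; exact hM

/-- `x·|f′(x)| ≤ (√(Λ/π) + |z|)·M` if `x^{Re z} ≤ M` (`e^{−Λu²} ≤ 1`, `0 < g < 1`).
[cite: Zhang2022LandauSiegel, §4 Lemma 4.4 (proof) p. 19] -/
theorem mul_norm_deriv_weight_le {Λ X : ℝ} (hΛ : 0 < Λ) (z : ℂ) {x M : ℝ} (hx : 0 < x)
    (hM : x ^ z.re ≤ M) :
    x * ‖(((-(Real.sqrt (Λ / π) * gauss Λ (Real.log (X / x)) / x)) : ℝ) : ℂ) * (x : ℂ) ^ z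
        + (gWeight Λ (X / x) : ℂ) * (z * (x : ℂ) ^ (z - 1))‖
      ≤ (Real.sqrt (Λ / π) + ‖z‖) * M := by
  have hM0 : 0 ≤ M := le_trans (Real.rpow_nonneg hx.le _) hM
  have hsq : 0 ≤ Real.sqrt (Λ / π) := Real.sqrt_nonneg _
  have hg0 : 0 < gWeight Λ (X / x) := gWeight_pos hΛ _
  have hg1 : gWeight Λ (X / x) < 1 := gWeight_lt_one hΛ _
  have hga : gauss Λ (Real.log (X / x)) ≤ 1 := gauss_le_one hΛ.le _
  have hga0 : 0 ≤ gauss Λ (Real.log (X / x)) := (gauss_pos Λ _).le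
  -- the two terms
  have h1 : x * ‖(((-(Real.sqrt (Λ / π) * gauss Λ (Real.log (X / x)) / x)) : ℝ) : ℂ) * (x : ℂ) ^ z‖
      ≤ Real.sqrt (Λ / π) * M := by
    rw [norm_mul, Complex.norm_real, Real.norm_eq_abs, abs_neg,
      abs_of_nonneg (by positivity), Complex.norm_cpow_eq_rpow_re_of_pos hx]
    calc x * (Real.sqrt (Λ / π) * gauss Λ (Real.log (X / x)) / x * x ^ z.re)
        = Real.sqrt (Λ / π) * gauss Λ (Real.log (X / x)) * x ^ z.re := by
          field_simp
      _ ≤ Real.sqrt (Λ / π) * 1 * M := by gcongr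
      _ = Real.sqrt (Λ / π) * M := by ring
  have h2 : x * ‖(gWeight Λ (X / x) : ℂ) * (z * (x : ℂ) ^ (z - 1))‖ ≤ ‖z‖ * M := by
    rw [norm_mul, norm_mul, Complex.norm_real, Real.norm_eq_abs, abs_of_pos hg0,
      Complex.norm_cpow_eq_rpow_re_of_pos hx, Complex.sub_re, Complex.one_re,
      Real.rpow_sub_one hx.ne']
    calc x * (gWeight Λ (X / x) * (‖z‖ * (x ^ z.re / x)))
        = gWeight Λ (X / x) * (‖z‖ * x ^ z.re) := by field_simp
      _ ≤ 1 * (‖z‖ * M) := by gcongr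
      _ = ‖z‖ * M := one_mul _
  calc _ ≤ x * (‖(((-(Real.sqrt (Λ / π) * gauss Λ (Real.log (X / x)) / x)) : ℝ) : ℂ) * (x : ℂ) ^ z‖
          + ‖(gWeight Λ (X / x) : ℂ) * (z * (x : ℂ) ^ (z - 1))‖) :=
        mul_le_mul_of_nonneg_left (norm_add_le _ _) hx.le
    _ ≤ Real.sqrt (Λ / π) * M + ‖z‖ * M := by rw [mul_add]; exact add_le_add h1 h2
    _ = (Real.sqrt (Λ / π) + ‖z‖) * M := by ring

/-! ### The partial-summation bound for the `g`-weighted sum over `D⁴ < n ≤ ⌊b⌋`, `b ≤ P²` -/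

/-- The core bound: for `𝓛 ≥ 2`, any `ψ ∈ Ψ`, `s ∈ Ω₃` and `D⁴ ≤ b ≤ P²`,
`|Σ_{D⁴<n≤b} ν(n)ψ(n)n^{−s}g(P^{9/5}/n)| ≤ e^{2π}|X₃(b,ψ)| + 2e^{2π}𝓛₁∫_{D⁴}^{b}|X₃(x,ψ)|x⁻¹dx`
(general-weight partial summation, `Section4.norm_sum_mul_weight_le`, with the bounds above:
`x^{1/2−σ} ≤ e^{2π}` on `[D⁴, P²]`, `√(𝓛³⁰/π) + |s₀−s| ≤ 𝓛¹⁵ + 𝓛₁ + 4 ≤ 2𝓛₁`).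
[cite: Zhang2022LandauSiegel, §4 Lemma 4.4 (proof) p. 19] -/
theorem norm_gSum_Ioc_le {D : ℕ} [NeZero D] (χ : DirichletCharacter ℂ D) (x : Chr D)
    (hℓ2 : 2 ≤ ell D) {s : ℂ} (hs : s ∈ Omega3 D) {b : ℝ} (hab : (D : ℝ) ^ 4 ≤ b)
    (hbP : b ≤ bigP D ^ 2) :
    ‖∑ n ∈ Finset.Ioc (D ^ 4) ⌊b⌋₊, nu χ n * x.ψ (n : ZMod x.p) * (n : ℂ) ^ (-s)
        * (gW D (bigP D ^ (9 / 5 : ℝ) / (n : ℝ)) : ℂ)‖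
      ≤ Real.exp (2 * Real.pi) * ‖X3 χ x b‖
        + 2 * Real.exp (2 * Real.pi) * ell1 D * ∫ y in (D : ℝ) ^ 4..b, ‖X3 χ x y‖ / y := by
  have hℓ1 : 1 ≤ ell D := le_trans one_le_two hℓ2
  have hℓ : 0 < ell D := lt_of_lt_of_le zero_lt_one hℓ1
  have hDne : D ≠ 0 := by
    rintro rfl
    simp [ell] at hℓ2; linarith
  have hD0 : (0 : ℝ) < D := by exact_mod_cast Nat.pos_of_ne_zero hDne
  have hD1 : (1 : ℝ) ≤ D := by exact_mod_cast Nat.one_le_iff_ne_zero.mpr hDne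
  have hP : 0 < bigP D := Real.exp_pos _
  have hP1 : 1 ≤ bigP D := by rw [bigP]; exact Real.one_le_exp (by positivity)
  have hX : 0 < bigP D ^ (9 / 5 : ℝ) := Real.rpow_pos_of_pos hP _
  have hΛ : 0 < ell D ^ 30 := by positivity
  have hα : alpha D = Real.pi / ell D ^ 9 := by rw [alpha, bigP, Real.log_exp]
  have hα0 : 0 < alpha D := by rw [hα]; positivity
  have hα4 : alpha D ≤ 1 / 4 := by
    rw [hα, div_le_div_iff₀ (by positivity) (by norm_num)]
    have h9 : (2 : ℝ) ^ 9 ≤ ell D ^ 9 := pow_le_pow_left₀ (by norm_num) hℓ2 9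
    nlinarith [Real.pi_lt_four]
  obtain ⟨hσ1, hσ2, ht⟩ := hs
  have ha0 : (0 : ℝ) < (D : ℝ) ^ 4 := by positivity
  -- the coefficients, the exponent and the weight
  set c : ℕ → ℂ := fun n => nu χ n * x.ψ (n : ZMod x.p) * (n : ℂ) ^ (-s0 D) with hc
  set z : ℂ := s0 D - s with hz
  have hzre : z.re = 1 / 2 - s.re := by
    rw [hz, s0, SmoothWeight.s0_def]; simp
  have hzim : z.im = 2 * Real.pi * t0 D - s.im := by
    rw [hz, s0, SmoothWeight.s0_def]; simp
  set X : ℝ := bigP D ^ (9 / 5 : ℝ) with hXdef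
  set f : ℝ → ℂ := fun y => (gWeight (ell D ^ 30) (X / y) : ℂ) * (y : ℂ) ^ z with hf
  set f' : ℝ → ℂ := fun y =>
    (((-(Real.sqrt (ell D ^ 30 / π) * gauss (ell D ^ 30) (Real.log (X / y)) / y)) : ℝ) : ℂ)
        * (y : ℂ) ^ z
      + (gWeight (ell D ^ 30) (X / y) : ℂ) * (z * (y : ℂ) ^ (z - 1)) with hf'
  -- rewrite the sum as `Σ_{⌊a⌋<n≤⌊b⌋} c(n) f(n)`
  have hsum : ∑ n ∈ Finset.Ioc (D ^ 4) ⌊b⌋₊, nu χ n * x.ψ (n : ZMod x.p) * (n : ℂ) ^ (-s)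
        * (gW D (bigP D ^ (9 / 5 : ℝ) / (n : ℝ)) : ℂ)
      = ∑ n ∈ Finset.Ioc ⌊((D : ℝ) ^ 4)⌋₊ ⌊b⌋₊, c n * f n := by
    rw [floor_natCast_pow_four]
    refine Finset.sum_congr rfl fun n hn => ?_
    have hn0 : (n : ℂ) ≠ 0 := by
      have : 0 < n := lt_of_le_of_lt (Nat.zero_le _) (Finset.mem_Ioc.mp hn).1
      exact_mod_cast this.ne'
    rw [hc, hf]
    simp only [gW]
    have e : (n : ℂ) ^ (-s) = (n : ℂ) ^ (-s0 D) * (n : ℂ) ^ z := by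
      rw [← Complex.cpow_add _ _ hn0, hz]; congr 1; ring
    rw [e]; push_cast; ring
  -- the supremum `x^{Re z} ≤ e^{2π}` on `[D⁴, P²]`
  set M : ℝ := Real.exp (2 * Real.pi) with hM
  have hM1 : 1 ≤ M := Real.one_le_exp (by positivity)
  have hP2α : (bigP D ^ 2) ^ (alpha D) = M := by
    rw [hM, bigP, ← Real.exp_nat_mul, ← Real.exp_mul, hα]
    congr 1
    field_simp
    norm_num
  have hMbound : ∀ y ∈ Set.Icc ((D : ℝ) ^ 4) b, y ^ z.re ≤ M := by
    intro y hy
    have hy1 : 1 ≤ y := le_trans (one_le_pow₀ hD1) hy.1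
    rcases le_or_gt z.re 0 with hre | hre
    · exact le_trans (Real.rpow_le_one_of_one_le_of_nonpos hy1 hre) hM1
    · calc y ^ z.re ≤ (bigP D ^ 2) ^ z.re :=
            Real.rpow_le_rpow (by linarith) (hy.2.trans hbP) hre.le
        _ ≤ (bigP D ^ 2) ^ (alpha D) :=
            Real.rpow_le_rpow_of_exponent_le (one_le_pow₀ hP1) (by rw [hzre]; linarith)
        _ = M := hP2α
  -- `|z| ≤ 𝓛₁ + 4`, `√(Λ/π) ≤ 𝓛¹⁵`, and `𝓛¹⁵ + 𝓛₁ + 4 ≤ 2𝓛₁`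
  have hznorm : ‖z‖ ≤ ell1 D + 4 := by
    have h1 : ‖z‖ ≤ |z.re| + |z.im| := Complex.norm_le_abs_re_add_abs_im z
    have h2 : |z.re| ≤ 1 := by
      rw [hzre, abs_le]; constructor <;> linarith
    have h3 : |z.im| ≤ ell1 D + 3 := by
      rw [hzim, show 2 * Real.pi * t0 D - s.im = -(s.im - 2 * Real.pi * t0 D) by ring, abs_neg]
      exact ht.le
    linarith
  have hsqrt : Real.sqrt (ell D ^ 30 / π) ≤ ell D ^ 15 := by
    rw [Real.sqrt_le_left (by positivity)]
    rw [div_le_iff₀ Real.pi_pos]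
    have hπ : (1 : ℝ) ≤ Real.pi := le_trans (by norm_num) Real.two_le_pi
    calc ell D ^ 30 = (ell D ^ 15) ^ 2 * 1 := by ring
      _ ≤ (ell D ^ 15) ^ 2 * Real.pi := mul_le_mul_of_nonneg_left hπ (by positivity)
  have hB2 : (Real.sqrt (ell D ^ 30 / π) + ‖z‖) * M ≤ 2 * Real.exp (2 * Real.pi) * ell1 D := by
    have h15 : ell D ^ 15 + 4 ≤ ell1 D := by
      rw [ell1]
      have h15' : 4 ≤ ell D ^ 15 := by
        have h2 : ell D ^ 2 ≤ ell D ^ 15 := pow_le_pow_right₀ hℓ1 (by norm_num)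
        nlinarith
      have h405 : ell D ^ 15 * ell D ^ 390 = ell D ^ 405 := by rw [← pow_add]
      have h390 : 2 ≤ ell D ^ 390 := le_trans hℓ2 (le_self_pow₀ hℓ1 (by norm_num))
      nlinarith [mul_le_mul h15' h390 (by norm_num) (by positivity), h405]
    have hsum' : Real.sqrt (ell D ^ 30 / π) + ‖z‖ ≤ 2 * ell1 D := by linarith
    calc (Real.sqrt (ell D ^ 30 / π) + ‖z‖) * M ≤ (2 * ell1 D) * M :=
          mul_le_mul_of_nonneg_right hsum' (le_trans zero_le_one hM1)
      _ = 2 * Real.exp (2 * Real.pi) * ell1 D := by rw [hM]; ring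
  -- hypotheses of the general-weight bound
  have hb0 : 0 < b := lt_of_lt_of_le ha0 hab
  have hfd : ∀ y ∈ Set.Icc ((D : ℝ) ^ 4) b, HasDerivAt f (f' y) y := fun y hy =>
    hasDerivAt_gWeight_mul_cpow hΛ hX z (ha0.trans_le hy.1)
  have hf'c : ContinuousOn f' (Set.Icc ((D : ℝ) ^ 4) b) := continuousOn_deriv_weight hΛ hX z ha0
  have hA : ‖f b‖ ≤ M := norm_weight_le hΛ z hb0 (hMbound b ⟨hab, le_rfl⟩)
  have hB : ∀ y ∈ Set.Icc ((D : ℝ) ^ 4) b, y * ‖f' y‖ ≤ 2 * Real.exp (2 * Real.pi) * ell1 D :=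
    fun y hy => le_trans (mul_norm_deriv_weight_le hΛ z (ha0.trans_le hy.1) (hMbound y hy)) hB2
  have hmain := norm_sum_mul_weight_le c ha0 hab hfd hf'c hA hB
  rw [← hsum] at hmain
  have hXs : ∀ y : ℝ, Xsum c ((D : ℝ) ^ 4) y = X3 χ x y := fun y => by
    rw [hc]; exact Xsum_eq_X3 χ x y
  simp_rw [hXs] at hmain
  rw [hM] at hmain
  exact hmain

end Literature.NumberTheory.LFunctions.Zhang2022.Section4

end
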